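import Mathlib
import HarnessLib
import Summits.NavierStokesRegularity.NavierStokesRegularity.Theses.IsobarTomography

/-!
# Sketch — crux ideas for `TubeAlternative` (stmt-NavierStokesRegularity-11739), ideator 1, round 1

First lemmas of the idea cards (they must elaborate; they need not be proved here):

* card `analytic-propagation-local-patch`: `isobaricDefect`, `KNSSLimitJointlyAnalytic`
  (Literature fact request), `AnalyticPropagation` (first lemma) — and the sorry-free reduction
  `analyticPropagation_of_analytic` showing the lever is exactly the identity theorem.
* card `syndetic-badness-two-sided-rate`: `TwoSidedVorticityRate` (first lemma),
  `LocalBlobClosure` (the sibling mechanism in local, scale-invariant form), `SyndeticBadness`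
  (the card's claim) and the arithmetic core `logWindow_bound` (proved).
* card `peak-pit-dichotomy`: `ZoomAtBadPeak` (first lemma: the eternal-window zoom with an interior
  bad spatial vorticity maximum), `PitHostedPeaksAreBlob` (nondegenerate pressure pits hosting the
  near-maximal vorticity imply the blob hypothesis).
-/

namespace Summit.NavierStokesRegularity.NavierStokesRegularity.Cruxes.TubeAlternative.SketchIdeator1

open Literature.Analysis.FluidPDE Set Filter Topology

local notation "ℝ³" => EuclideanSpace ℝ (Fin 3)

/-! ## Card A — analytic propagation of isobaricity -/

/-- The isobaric defect `h = ω_v · ∇q` as a space–time function `(t, x) ↦ ⟪curl v(t) x, ∇q(t) x⟫`. -/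
noncomputable def isobaricDefect (v : ℝ → ℝ³ → ℝ³) (q : ℝ → ℝ³ → ℝ) : ℝ × ℝ³ → ℝ :=
  fun z => inner ℝ (curl (v z.1) z.2) (gradient (q z.1) z.2)

/-- Literature fact request (Dong–Zhang 2020 time analyticity of bounded mild solutions,
arXiv:1907.01687, + spatial analyticity of `L^∞` mild solutions, Guberović 2010 / Giga–Sawada 2003 /
Masuda 1967): a KNSS blow-up limit with a classical pressure has a jointly real-analytic isobaric
defect on the open half space–time `(-∞,0) × ℝ³` (`∇q = Δv − ∂ₜv − (v·∇)v` is analytic with `v`). -/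
def KNSSLimitJointlyAnalytic : Prop :=
  ∀ (v : ℝ → ℝ³ → ℝ³) (q : ℝ → ℝ³ → ℝ), IsKNSSBlowupLimit v →
    IsClassicalNSSolutionOn (Set.Iio 0) 1 0 v q →
    AnalyticOnNhd ℝ (isobaricDefect v q) (Set.Iio 0 ×ˢ Set.univ)

/-- FIRST LEMMA of card A (`AnalyticPropagation`): an isobaric PATCH (an open space–time set on
which `ω_v·∇q = 0`) of a KNSS blow-up limit is automatically global. -/
def AnalyticPropagation : Prop :=
  ∀ (v : ℝ → ℝ³ → ℝ³) (q : ℝ → ℝ³ → ℝ), IsKNSSBlowupLimit v →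
    IsClassicalNSSolutionOn (Set.Iio 0) 1 0 v q →
    (∃ U : Set (ℝ × ℝ³), IsOpen U ∧ U.Nonempty ∧ U ⊆ Set.Iio 0 ×ˢ Set.univ ∧
        ∀ z ∈ U, isobaricDefect v q z = 0) →
    ∀ t < 0, ∀ x : ℝ³, inner ℝ (curl (v t) x) (gradient (q t) x) = 0

/-- The lever is exactly the identity theorem: joint analyticity ⇒ `AnalyticPropagation`
(sorry-free; Mathlib `AnalyticOnNhd.eqOn_zero_of_preconnected_of_eventuallyEq_zero`). -/
theorem analyticPropagation_of_analytic (hA : KNSSLimitJointlyAnalytic) : AnalyticPropagation := by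
  intro v q hv hvq hU t ht x
  obtain ⟨U, hUo, ⟨z₀, hz₀⟩, hUS, hU0⟩ := hU
  have hf := hA v q hv hvq
  have hpre : IsPreconnected ((Set.Iio (0 : ℝ)) ×ˢ (Set.univ : Set ℝ³)) :=
    (isPreconnected_Iio).prod isPreconnected_univ
  have hev : isobaricDefect v q =ᶠ[𝓝 z₀] 0 := by
    filter_upwards [hUo.mem_nhds hz₀] with z hz
    simpa using hU0 z hz
  have key := hf.eqOn_zero_of_preconnected_of_eventuallyEq_zero hpre (hUS hz₀) hev
  have hmem : ((t, x) : ℝ × ℝ³) ∈ (Set.Iio (0 : ℝ)) ×ˢ (Set.univ : Set ℝ³) := ⟨ht, Set.mem_univ _⟩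
  have := key hmem
  simpa [isobaricDefect] using this

/-- The bet of card A's line (`LocalPatchSelection`, the transferred crux C⁺): under the hypotheses
of `TubeAlternative`, SOME KNSS blow-up limit with a classical pressure is not slice-wise constant
and carries an isobaric patch. -/
def LocalPatchSelection : Prop :=
  ∀ (ν T : ℝ), 0 < ν → 0 < T → ∀ (u : ℝ → ℝ³ → ℝ³) (p : ℝ → ℝ³ → ℝ),
    IsMaximalSmoothSolution ν 0 u p T → IsLerayHopfOn T ν 0 (u 0) u →
    HasRapidSpatialDecay (u 0) → IsTypeIBlowup u T →
    (¬ ∃ κ : ℝ, 0 < κ ∧ ∃ Ω : ℝ → ℝ, ∃ t₀ ∈ Set.Ico 0 T, ∀ t ∈ Set.Ico t₀ T,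
      (∃ x : ℝ³, Ω t < ‖curl (u t) x‖) ∧ ∀ x : ℝ³, Ω t < ‖curl (u t) x‖ →
        κ * ‖curl (u t) x‖ ^ 2 * Laplacian.laplacian (p t) x ≤
          iteratedFDeriv ℝ 2 (p t) x ![curl (u t) x, curl (u t) x]) →
    ∃ (v : ℝ → ℝ³ → ℝ³) (q : ℝ → ℝ³ → ℝ), IsKNSSBlowupLimit v ∧
      IsClassicalNSSolutionOn (Set.Iio 0) 1 0 v q ∧
      (∃ U : Set (ℝ × ℝ³), IsOpen U ∧ U.Nonempty ∧ U ⊆ Set.Iio 0 ×ˢ Set.univ ∧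
        ∀ z ∈ U, isobaricDefect v q z = 0) ∧
      ¬ (∀ t < 0, ∃ b : ℝ³, v t = fun _ => b)

/-- Card A's transfer is honest: C⁺ := `AnalyticPropagation ∧ LocalPatchSelection` implies the crux
verbatim (sorry-free, three lines of logic). -/
theorem tubeAlternative_of_patch (hA : AnalyticPropagation) (hP : LocalPatchSelection) :
    Summit.NavierStokesRegularity.NavierStokesRegularity.Theses.IsobarTomography.TubeAlternative := by
  intro ν T hν hT u p hmax hLH hdec hI hnb
  obtain ⟨v, q, hv, hvq, hU, hnc⟩ := hP ν T hν hT u p hmax hLH hdec hI hnb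
  exact ⟨v, q, hv, hvq, hA v q hv hvq hU, hnc⟩

/-! ## Card B — syndetic badness from the two-sided Type-I vorticity law -/

/-- FIRST LEMMA of card B (`TwoSidedVorticityRate`): at a Type-I singular time of a finite-energy
classical solution from a rapidly decaying datum the vorticity maximum obeys a TWO-SIDED Type-I law
`c/(T−t) ≤ ‖ω(t)‖_∞ ≤ C/(T−t)` for `t` near `T`. Upper: parabolic smoothing under the Type-I
velocity bound. Lower (the content): if `(T−t_k)‖ω(t_k)‖_∞ → 0`, the KNSS zoom at velocity
near-maxima at times `t_k` has an irrotational final slice, hence (backward uniqueness for the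
vorticity equation + bounded harmonic ⇒ constant + mildness) is a NON-ZERO constant, which the
Albritton–Barker scale-invariant bound inherited from finite energy forbids. -/
def TwoSidedVorticityRate : Prop :=
  ∀ (ν T : ℝ), 0 < ν → 0 < T → ∀ (u : ℝ → ℝ³ → ℝ³) (p : ℝ → ℝ³ → ℝ),
    IsMaximalSmoothSolution ν 0 u p T → IsLerayHopfOn T ν 0 (u 0) u →
    HasRapidSpatialDecay (u 0) → IsTypeIBlowup u T →
    ∃ c C : ℝ, 0 < c ∧ ∃ t₁ ∈ Set.Ico 0 T, ∀ t ∈ Set.Ico t₁ T,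
      (∃ x : ℝ³, c / (T - t) ≤ ‖curl (u t) x‖) ∧ ∀ x : ℝ³, ‖curl (u t) x‖ ≤ C / (T - t)

/-- The blob hypothesis of the route with parameter `κ`, localised to a time window `W ⊆ [0,T)`
(verbatim the route's clause with `Set.Ico t₀ T` replaced by `W`). -/
def BlobOn (κ : ℝ) (W : Set ℝ) (u : ℝ → ℝ³ → ℝ³) (p : ℝ → ℝ³ → ℝ) : Prop :=
  ∃ Ω : ℝ → ℝ, ∀ t ∈ W, (∃ x : ℝ³, Ω t < ‖curl (u t) x‖) ∧ ∀ x : ℝ³, Ω t < ‖curl (u t) x‖ →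
    κ * ‖curl (u t) x‖ ^ 2 * Laplacian.laplacian (p t) x ≤
      iteratedFDeriv ℝ 2 (p t) x ![curl (u t) x, curl (u t) x]

/-- `LocalBlobClosure` — the sibling crux `BlobRiccatiClosure`'s mechanism in the local,
scale-invariant form this card leans on (UNPROVED; dies with K1): blob(κ) on a window `[t_e,t_f]` of
at most `M` vorticity turn-over times controls the growth of `‖ω‖_∞` across the window by a factor
`F(κ, M)` independent of the solution and of `ν`. -/
def LocalBlobClosure : Prop :=
  ∀ κ M : ℝ, 0 < κ → 0 < M → ∃ F : ℝ, ∀ (ν T : ℝ), 0 < ν → 0 < T →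
    ∀ (u : ℝ → ℝ³ → ℝ³) (p : ℝ → ℝ³ → ℝ), IsClassicalNSSolutionOn (Set.Ico 0 T) ν 0 u p →
    IsLerayHopfOn T ν 0 (u 0) u → HasRapidSpatialDecay (u 0) →
    ∀ t_e t_f : ℝ, 0 ≤ t_e → t_e < t_f → t_f < T → BlobOn κ (Set.Icc t_e t_f) u p →
    ∀ W_e : ℝ, (∀ x : ℝ³, ‖curl (u t_e) x‖ ≤ W_e) → (t_f - t_e) * W_e ≤ M →
      ∀ x : ℝ³, ‖curl (u t_f) x‖ ≤ F * W_e

/-- The card's CLAIM (`SyndeticBadness`): under the crux hypotheses every blob parameter `κ` fails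
SYNDETICALLY in logarithmic time — there is `Λ > 1` such that every late window `[t, T − (T−t)/Λ]`
contains a time at which blob(κ) fails for EVERY threshold choice, i.e. `¬ BlobOn κ {t'}` at some
`t'` of the window. (From `TwoSidedVorticityRate`, `LocalBlobClosure` and `logWindow_bound`.) -/
def SyndeticBadness : Prop :=
  ∀ (ν T : ℝ), 0 < ν → 0 < T → ∀ (u : ℝ → ℝ³ → ℝ³) (p : ℝ → ℝ³ → ℝ),
    IsMaximalSmoothSolution ν 0 u p T → IsLerayHopfOn T ν 0 (u 0) u →
    HasRapidSpatialDecay (u 0) → IsTypeIBlowup u T →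
    (¬ ∃ κ : ℝ, 0 < κ ∧ ∃ Ω : ℝ → ℝ, ∃ t₀ ∈ Set.Ico 0 T, ∀ t ∈ Set.Ico t₀ T,
      (∃ x : ℝ³, Ω t < ‖curl (u t) x‖) ∧ ∀ x : ℝ³, Ω t < ‖curl (u t) x‖ →
        κ * ‖curl (u t) x‖ ^ 2 * Laplacian.laplacian (p t) x ≤
          iteratedFDeriv ℝ 2 (p t) x ![curl (u t) x, curl (u t) x]) →
    ∀ κ : ℝ, 0 < κ → ∃ Λ : ℝ, 1 < Λ ∧ ∃ t₁ ∈ Set.Ico 0 T, ∀ t ∈ Set.Ico t₁ T,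
      ∃ t' ∈ Set.Icc t (T - (T - t) / Λ), ¬ BlobOn κ {t'} u p

/-- Arithmetic core of card B (proved): a good window `[t_e, t_f]` on which the vorticity maximum
grows by at most the factor `F`, squeezed between the two-sided Type-I law, has bounded logarithmic
length: `T − t_e ≤ (F·C/c)·(T − t_f)`. -/
theorem logWindow_bound {T t_e t_f c C F W_e W_f : ℝ} (hte : t_e < T) (htf : t_f < T)
    (hc : 0 < c) (hF : 0 ≤ F)
    (hlow : c / (T - t_f) ≤ W_f) (hgrow : W_f ≤ F * W_e) (hup : W_e ≤ C / (T - t_e)) :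
    T - t_e ≤ F * C / c * (T - t_f) := by
  have h1 : 0 < T - t_f := sub_pos.mpr htf
  have h2 : 0 < T - t_e := sub_pos.mpr hte
  have key : c / (T - t_f) ≤ F * (C / (T - t_e)) := le_trans hlow (le_trans hgrow (by gcongr))
  rw [div_le_iff₀ h1] at key
  -- key : c ≤ F * (C / (T - t_e)) * (T - t_f)
  have key' : c * (T - t_e) ≤ F * C * (T - t_f) := by
    have := mul_le_mul_of_nonneg_right key h2.le
    calc c * (T - t_e) ≤ F * (C / (T - t_e)) * (T - t_f) * (T - t_e) := this
      _ = F * C * (T - t_f) * ((T - t_e) / (T - t_e)) := by ring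
      _ = F * C * (T - t_f) := by rw [div_self h2.ne', mul_one]
  rw [div_mul_eq_mul_div, le_div_iff₀ hc]
  linarith [key']

/-! ## Card C — zoom bookkeeping with an interior bad peak; pits hosting peaks are blobs -/

/-- FIRST LEMMA of card C (`ZoomAtBadPeak`, the eternal-window zoom): under the crux hypotheses
some KNSS blow-up limit with a classical pressure is defined as a bounded smooth solution BEYOND
time `0` and carries an INTERIOR time `t₀ < 0` at which its vorticity attains a positive spatial
maximum at a point where the axial pressure curvature is non-positive (the `κ → 0` shadow of the
failed blob inequality); in particular it is not slice-wise constant. -/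
def ZoomAtBadPeak : Prop :=
  ∀ (ν T : ℝ), 0 < ν → 0 < T → ∀ (u : ℝ → ℝ³ → ℝ³) (p : ℝ → ℝ³ → ℝ),
    IsMaximalSmoothSolution ν 0 u p T → IsLerayHopfOn T ν 0 (u 0) u →
    HasRapidSpatialDecay (u 0) → IsTypeIBlowup u T →
    (¬ ∃ κ : ℝ, 0 < κ ∧ ∃ Ω : ℝ → ℝ, ∃ t₀ ∈ Set.Ico 0 T, ∀ t ∈ Set.Ico t₀ T,
      (∃ x : ℝ³, Ω t < ‖curl (u t) x‖) ∧ ∀ x : ℝ³, Ω t < ‖curl (u t) x‖ →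
        κ * ‖curl (u t) x‖ ^ 2 * Laplacian.laplacian (p t) x ≤
          iteratedFDeriv ℝ 2 (p t) x ![curl (u t) x, curl (u t) x]) →
    ∃ (v : ℝ → ℝ³ → ℝ³) (q : ℝ → ℝ³ → ℝ) (a : ℝ), 0 < a ∧ IsKNSSBlowupLimit v ∧
      IsClassicalNSSolutionOn (Set.Iio a) 1 0 v q ∧ (∃ C : ℝ, ∀ t < a, ∀ x, ‖v t x‖ ≤ C) ∧
      ∃ t₀ : ℝ, t₀ < 0 ∧ ∃ x₀ : ℝ³, 0 < ‖curl (v t₀) x₀‖ ∧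
        (∀ x : ℝ³, ‖curl (v t₀) x‖ ≤ ‖curl (v t₀) x₀‖) ∧
        iteratedFDeriv ℝ 2 (q t₀) x₀ ![curl (v t₀) x₀, curl (v t₀) x₀] ≤ 0

/-- `PitHostedPeaksAreBlob` (card C, provable-now direction of the peak–pit dichotomy): if at every
late time every near-maximal vorticity point `x` (above a threshold `Ω t` exceeded somewhere) has a
pressure Hessian bounded below along the vorticity by `μ‖ω(t,x)‖·|ω(t,x)|²`-worth of curvature —
precisely `μ ‖curl u x‖ * ‖curl u x‖² ≤ D²p[ω,ω]` with `μ > 0` scale-free — then the blob hypothesis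
holds with `κ = 2μ … `; stated here in the clean sufficient form "uniformly convex pits host the
peaks ⇒ blob(κ)" with the trace bound `Δp ≤ ‖ω‖²/2`. -/
def PitHostedPeaksAreBlob : Prop :=
  ∀ (T : ℝ) (u : ℝ → ℝ³ → ℝ³) (p : ℝ → ℝ³ → ℝ) (μ : ℝ), 0 < μ →
    (∀ t ∈ Set.Ico 0 T, ∀ x : ℝ³, Laplacian.laplacian (p t) x ≤ ‖curl (u t) x‖ ^ 2 / 2) →
    (∃ Ω : ℝ → ℝ, ∃ t₀ ∈ Set.Ico 0 T, ∀ t ∈ Set.Ico t₀ T, (∃ x : ℝ³, Ω t < ‖curl (u t) x‖) ∧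
      ∀ x : ℝ³, Ω t < ‖curl (u t) x‖ →
        μ * ‖curl (u t) x‖ ^ 2 * ‖curl (u t) x‖ ^ 2 ≤
          iteratedFDeriv ℝ 2 (p t) x ![curl (u t) x, curl (u t) x]) →
    ∃ κ : ℝ, 0 < κ ∧ ∃ Ω : ℝ → ℝ, ∃ t₀ ∈ Set.Ico 0 T, ∀ t ∈ Set.Ico t₀ T,
      (∃ x : ℝ³, Ω t < ‖curl (u t) x‖) ∧ ∀ x : ℝ³, Ω t < ‖curl (u t) x‖ →
        κ * ‖curl (u t) x‖ ^ 2 * Laplacian.laplacian (p t) x ≤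
          iteratedFDeriv ℝ 2 (p t) x ![curl (u t) x, curl (u t) x]

/-- `PitHostedPeaksAreBlob` is elementary (κ = 2μ): proved. -/
theorem pitHostedPeaksAreBlob_holds : PitHostedPeaksAreBlob := by
  intro T u p μ hμ htr ⟨Ω, t₀, ht₀, h⟩
  refine ⟨2 * μ, by positivity, Ω, t₀, ht₀, fun t ht => ⟨(h t ht).1, fun x hx => ?_⟩⟩
  have hx' := (h t ht).2 x hx
  have hl := htr t ⟨le_trans ht₀.1 ht.1, ht.2⟩ x
  have hw : 0 ≤ ‖curl (u t) x‖ ^ 2 := by positivity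
  calc 2 * μ * ‖curl (u t) x‖ ^ 2 * Laplacian.laplacian (p t) x
      ≤ 2 * μ * ‖curl (u t) x‖ ^ 2 * (‖curl (u t) x‖ ^ 2 / 2) := by
        apply mul_le_mul_of_nonneg_left hl; positivity
    _ = μ * ‖curl (u t) x‖ ^ 2 * ‖curl (u t) x‖ ^ 2 := by ring
    _ ≤ _ := hx'

/-! ## Card A, transfer — the scale-invariant isobaric ACTION at the peaks -/

/-- The scale-invariant ISOBARIC ACTION of `(u,p)` on the backward parabolic cylinder of the local
vorticity scale at `(t,x)`: `𝒜(t,x) := ν⁻² ∫_{t−1/|ω(t,x)|}^{t} ∫_{B(x, √(ν/|ω(t,x)|))} |ω·∇p| dy ds`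
(dimensionless: `[ω∇p][L³T] = L⁴/T² = [ν]²`). -/
noncomputable def isobaricAction (ν : ℝ) (u : ℝ → ℝ³ → ℝ³) (p : ℝ → ℝ³ → ℝ) (t : ℝ) (x : ℝ³) : ℝ :=
  ν⁻¹ ^ 2 * ∫ z in (Set.Ioo (t - 1 / ‖curl (u t) x‖) t) ×ˢ Metric.ball x (Real.sqrt (ν / ‖curl (u t) x‖)),
    |isobaricDefect u p z|

/-- C⁺ of card A (`PeakActionDecay`, the transferred crux): at a Type-I singular time with failed
blob hypothesis, the isobaric action around the near-maximal vorticity points is NOT bounded away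
from zero: for every `η > 0` and `θ < 1` there are late `θ`-near-max peaks with action `< η`. -/
def PeakActionDecay : Prop :=
  ∀ (ν T : ℝ), 0 < ν → 0 < T → ∀ (u : ℝ → ℝ³ → ℝ³) (p : ℝ → ℝ³ → ℝ),
    IsMaximalSmoothSolution ν 0 u p T → IsLerayHopfOn T ν 0 (u 0) u →
    HasRapidSpatialDecay (u 0) → IsTypeIBlowup u T →
    (¬ ∃ κ : ℝ, 0 < κ ∧ ∃ Ω : ℝ → ℝ, ∃ t₀ ∈ Set.Ico 0 T, ∀ t ∈ Set.Ico t₀ T,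
      (∃ x : ℝ³, Ω t < ‖curl (u t) x‖) ∧ ∀ x : ℝ³, Ω t < ‖curl (u t) x‖ →
        κ * ‖curl (u t) x‖ ^ 2 * Laplacian.laplacian (p t) x ≤
          iteratedFDeriv ℝ 2 (p t) x ![curl (u t) x, curl (u t) x]) →
    ∀ η θ : ℝ, 0 < η → 0 < θ → θ < 1 → ∀ t₁ ∈ Set.Ico 0 T, ∃ t ∈ Set.Ico t₁ T, ∃ x : ℝ³,
      0 < ‖curl (u t) x‖ ∧ (∀ y : ℝ³, θ * ‖curl (u t) y‖ ≤ ‖curl (u t) x‖) ∧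
      isobaricAction ν u p t x < η

/-- `SharpDichotomy` (card A, provable now modulo the analyticity fact, KNSS compactness and the
Albritton–Barker / two-sided-rate bookkeeping): under the crux hypotheses WITHOUT the blob clause,
either the crux's conclusion already holds, or the isobaric action is uniformly positive at every
late near-maximal vorticity point. Contrapositive of "zoom where the action degenerates; the limit
has `∫_{Q₁}|h| = 0`, an open isobaric patch, hence is globally isobaric by `AnalyticPropagation`". -/
def SharpDichotomy : Prop :=
  ∀ (ν T : ℝ), 0 < ν → 0 < T → ∀ (u : ℝ → ℝ³ → ℝ³) (p : ℝ → ℝ³ → ℝ),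
    IsMaximalSmoothSolution ν 0 u p T → IsLerayHopfOn T ν 0 (u 0) u →
    HasRapidSpatialDecay (u 0) → IsTypeIBlowup u T →
    (∃ (v : ℝ → ℝ³ → ℝ³) (q : ℝ → ℝ³ → ℝ), IsKNSSBlowupLimit v ∧
      IsClassicalNSSolutionOn (Set.Iio 0) 1 0 v q ∧
      (∀ t < 0, ∀ x : ℝ³, inner ℝ (curl (v t) x) (gradient (q t) x) = 0) ∧
      ¬ (∀ t < 0, ∃ b : ℝ³, v t = fun _ => b)) ∨
    (∃ η θ : ℝ, 0 < η ∧ 0 < θ ∧ θ < 1 ∧ ∃ t₁ ∈ Set.Ico 0 T, ∀ t ∈ Set.Ico t₁ T, ∀ x : ℝ³,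
      0 < ‖curl (u t) x‖ → (∀ y : ℝ³, θ * ‖curl (u t) y‖ ≤ ‖curl (u t) x‖) →
      η ≤ isobaricAction ν u p t x)

/-- The transfer is honest: `SharpDichotomy ∧ PeakActionDecay ⇒ TubeAlternative` (sorry-free). -/
theorem tubeAlternative_of_action (hD : SharpDichotomy) (hP : PeakActionDecay) :
    Summit.NavierStokesRegularity.NavierStokesRegularity.Theses.IsobarTomography.TubeAlternative := by
  intro ν T hν hT u p hmax hLH hdec hI hnb
  rcases hD ν T hν hT u p hmax hLH hdec hI with h | ⟨η, θ, hη, hθ, hθ1, t₁, ht₁, hall⟩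
  · exact h
  · exfalso
    obtain ⟨t, ht, x, hpos, hnear, hlt⟩ := hP ν T hν hT u p hmax hLH hdec hI hnb η θ hη hθ hθ1 t₁ ht₁
    exact absurd (hall t ht x hpos hnear) (not_le.mpr hlt)

/-! ## Card B, transfer — the crux under syndetic failure -/

/-- The crux with its blob-failure hypothesis STRENGTHENED to syndetic failure in log-time (weaker
statement; what card B reduces the crux to). -/
def TubeAlternativeSyndetic : Prop :=
  ∀ (ν T : ℝ), 0 < ν → 0 < T → ∀ (u : ℝ → ℝ³ → ℝ³) (p : ℝ → ℝ³ → ℝ),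
    IsMaximalSmoothSolution ν 0 u p T → IsLerayHopfOn T ν 0 (u 0) u →
    HasRapidSpatialDecay (u 0) → IsTypeIBlowup u T →
    (∀ κ : ℝ, 0 < κ → ∃ Λ : ℝ, 1 < Λ ∧ ∃ t₁ ∈ Set.Ico 0 T, ∀ t ∈ Set.Ico t₁ T,
      ∃ t' ∈ Set.Icc t (T - (T - t) / Λ), ¬ BlobOn κ {t'} u p) →
    ∃ (v : ℝ → ℝ³ → ℝ³) (q : ℝ → ℝ³ → ℝ), IsKNSSBlowupLimit v ∧
      IsClassicalNSSolutionOn (Set.Iio 0) 1 0 v q ∧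
      (∀ t < 0, ∀ x : ℝ³, inner ℝ (curl (v t) x) (gradient (q t) x) = 0) ∧
      ¬ (∀ t < 0, ∃ b : ℝ³, v t = fun _ => b)

/-- Card B's transfer is honest: `SyndeticBadness ∧ TubeAlternativeSyndetic ⇒ TubeAlternative`
(sorry-free). -/
theorem tubeAlternative_of_syndetic (hS : SyndeticBadness) (hT : TubeAlternativeSyndetic) :
    Summit.NavierStokesRegularity.NavierStokesRegularity.Theses.IsobarTomography.TubeAlternative := by
  intro ν T hν hT' u p hmax hLH hdec hI hnb
  exact hT ν T hν hT' u p hmax hLH hdec hI (hS ν T hν hT' u p hmax hLH hdec hI hnb)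

/-! ## Card C — the pressure pit as zoom centre -/

/-- `PeakPitAlternative` (card C's reformulation of the failed blob hypothesis, degenerate-pit /
separation split): under the crux hypotheses, for every `θ < 1`, EITHER (degenerate pit) some
eternal-window KNSS-type limit has an interior point which is a pressure critical point with
positive-semidefinite Hessian, hosts `θ`-near-maximal vorticity, and has VANISHING axial pressure
curvature `D²q[ω,ω] = 0` (so the isobaric defect vanishes there to second order along the vortex
line), OR (separation) there is `d₀ > 0` such that at times arbitrarily close to `T` every
`θ`-near-maximal vorticity point lies at distance `≥ d₀·√(ν/|ω|)` from every local pressure minimum. -/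
def PeakPitAlternative : Prop :=
  ∀ (ν T : ℝ), 0 < ν → 0 < T → ∀ (u : ℝ → ℝ³ → ℝ³) (p : ℝ → ℝ³ → ℝ),
    IsMaximalSmoothSolution ν 0 u p T → IsLerayHopfOn T ν 0 (u 0) u →
    HasRapidSpatialDecay (u 0) → IsTypeIBlowup u T →
    (¬ ∃ κ : ℝ, 0 < κ ∧ ∃ Ω : ℝ → ℝ, ∃ t₀ ∈ Set.Ico 0 T, ∀ t ∈ Set.Ico t₀ T,
      (∃ x : ℝ³, Ω t < ‖curl (u t) x‖) ∧ ∀ x : ℝ³, Ω t < ‖curl (u t) x‖ →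
        κ * ‖curl (u t) x‖ ^ 2 * Laplacian.laplacian (p t) x ≤
          iteratedFDeriv ℝ 2 (p t) x ![curl (u t) x, curl (u t) x]) →
    ∀ θ : ℝ, 0 < θ → θ < 1 →
    (∃ (v : ℝ → ℝ³ → ℝ³) (q : ℝ → ℝ³ → ℝ) (a : ℝ), 0 < a ∧ IsKNSSBlowupLimit v ∧
      IsClassicalNSSolutionOn (Set.Iio a) 1 0 v q ∧
      ∃ t₀ : ℝ, t₀ < 0 ∧ ∃ x₀ : ℝ³, gradient (q t₀) x₀ = 0 ∧
        (∀ e : ℝ³, 0 ≤ iteratedFDeriv ℝ 2 (q t₀) x₀ ![e, e]) ∧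
        0 < ‖curl (v t₀) x₀‖ ∧ (∀ x : ℝ³, θ * ‖curl (v t₀) x‖ ≤ ‖curl (v t₀) x₀‖) ∧
        iteratedFDeriv ℝ 2 (q t₀) x₀ ![curl (v t₀) x₀, curl (v t₀) x₀] = 0) ∨
    (∃ d₀ : ℝ, 0 < d₀ ∧ ∀ t₁ ∈ Set.Ico 0 T, ∃ t ∈ Set.Ico t₁ T, ∀ x : ℝ³,
      0 < ‖curl (u t) x‖ → (∀ y : ℝ³, θ * ‖curl (u t) y‖ ≤ ‖curl (u t) x‖) →
      ∀ y : ℝ³, gradient (p t) y = 0 → (∀ e : ℝ³, 0 ≤ iteratedFDeriv ℝ 2 (p t) y ![e, e]) →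
        d₀ * Real.sqrt (ν / ‖curl (u t) x‖) ≤ dist x y)

/-- Second-order isobaricity at a degenerate pit (card C, elementary linear algebra behind the
"free 2-jet"): for a positive-semidefinite symmetric bilinear form `B` on `ℝ³` and a vector `w` with
`B w w = 0`, the whole row vanishes: `B w e = 0` for all `e`. Stated over `Matrix` to stay
elementary; PROVED. -/
theorem psd_row_vanishes (M : Matrix (Fin 3) (Fin 3) ℝ) (hM : M.PosSemidef) (w : Fin 3 → ℝ)
    (hw : dotProduct (star w) (M.mulVec w) = 0) : M.mulVec w = 0 :=
  (hM.dotProduct_mulVec_zero_iff w).1 hw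

end Summit.NavierStokesRegularity.NavierStokesRegularity.Cruxes.TubeAlternative.SketchIdeator1
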